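import Summits.MatrixMultiplication.MatrixMultiplication.Theorems.SaturationLadderLevelTwo
import Summits.MatrixMultiplication.MatrixMultiplication.Theorems.SaturationLadderLevelTwoK2
import Summits.MatrixMultiplication.MatrixMultiplication.Theorems.SaturationLadderLevelTwoK3
import Summits.MatrixMultiplication.MatrixMultiplication.Theorems.SaturationLadderLevelTwoK4
import Summits.MatrixMultiplication.MatrixMultiplication.Theorems.SaturationLadderLevelTwoK5
import Summits.MatrixMultiplication.MatrixMultiplication.Theorems.SaturationLadderLevelTwoK6
import Summits.MatrixMultiplication.MatrixMultiplication.Theorems.SaturationLadderLevelTwoK10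
import Summits.MatrixMultiplication.MatrixMultiplication.Theorems.SaturationLadderLevelOneFar
import Summits.MatrixMultiplication.MatrixMultiplication.Theorems.SaturationLadderFarRate
import Summits.MatrixMultiplication.MatrixMultiplication.Theorems.SaturationLadderDefectFloor
import Summits.MatrixMultiplication.MatrixMultiplication.Theorems.SaturationLadderDefectFloorFar
import Summits.MatrixMultiplication.MatrixMultiplication.Theorems.SaturationLadderDefectFloorNear
import Summits.MatrixMultiplication.MatrixMultiplication.Theorems.SaturationLadderDefectFloorMid
import Summits.MatrixMultiplication.MatrixMultiplication.Theorems.SaturationLadderDefectFloorWide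
import Summits.MatrixMultiplication.MatrixMultiplication.Theorems.SaturationLadderDefectFloorFixedQ
import Summits.MatrixMultiplication.MatrixMultiplication.Theorems.SaturationLadderDefectFloorSeven
import Summits.MatrixMultiplication.MatrixMultiplication.Theorems.SaturationLadderDefectFloorTwelve
import Summits.MatrixMultiplication.MatrixMultiplication.Theorems.SaturationLadderDefectFloorTwoHundred
import Literature.Barriers.MatrixMultiplication.RectangularBarrierOmegaTwoCW1
import Literature.Computability.AlgebraicComplexity.BigCwFourthOmega
import Literature.Computability.AlgebraicComplexity.RectangularExponentProofs
import HarnessLib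

/-!
# The defect ladder of record `δ_k = ω(1,k,1) − (k+1)`, BY NAME, in one module (route `SaturationLadder`, lens 1, gen 23)

Cell `decomp-mm` (D-0178), lens 1 «grading / quantitative ladder», generation 23.  Node of record: the crux
`TailDescentTwo` (stmt-MatrixMultiplication-29474) of the OPEN route `SaturationLadder` (rev 7, cut unchanged:
`closes (SubexpSaturation) (SubexpToPoly) (PolyToFinite) (TailDescentTwo) (SquareFromTwo)`):

  `TailDescentTwo : (∃ k : ℕ, 3 ≤ k ∧ ω(1,k,1) = k+1) → ω(1,2,1) = 3`.

Its quantitative ladder is the DEFECT `δ_k := ω(1,k,1) − (k+1) ≥ 0` (`add_one_le_omegaRect_one_mid_one`;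
non-increasing in `k`, `omegaRect_one_mid_one_le_add`).  Generations 20–22 priced `δ_k` from ABOVE at the grades
`k = 2 … 10, 12, 15, 20, 30, 50, 100, 200, 500, 1000` (laser method on `CW_q`, levels 1 and 2, `decide`d integer
certificates) and from BELOW for the producing method family (the Christandl–Le Gall–Lysikov–Zuiddam `ζ^θ`-barrier for
`CW_q` T-methods, 24 certified rows and a uniform strict floor), in SIXTEEN landed modules.  This file is the INDEX the
cell's critic asked for (decomp-mm STATUS l.1386, s3): every row of the ladder of record as ONE conjunction with literal
types, proved by name — no new certificate, no restated proof — plus (§4) the one price the LAWS of the profile put on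
the node (the chord of the convex profile through an onset), in the same currency.

## The table of record (all unconditional theorems of the tree; `δ̄_k` = proved upper bound on `δ_k`,
`β` = proved `CW_q`-method floor at the `q` of record: no `CW_q`-method bound on `ω(k)` lies below `k + 1 + β`)

| k    | δ̄_k            | instrument (module)                          | β (q)            | δ̄_k / β |
|------|-----------------|----------------------------------------------|------------------|---------|
| 3/10 | ω(1,3/10,1) = 2 | level 2, `SaturationLadderLevelTwo`          | —                | —       |
| 1    | ω − 2 ≤ 0.37295 | `LeGall2014_cw4_omega_le` (CW⊗⁴, Le Gall 2014 Table 2) | —           | —       |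
| 2    | 8/31 = 0.2581   | level 2, `…LevelTwoK2`                       | 0.1039 (6)       | 2.5     |
| 3    | 4/19 = 0.2105   | level 2, `…LevelTwoK3`                       | 0.0626 (6)       | 3.4     |
| 4    | 8/43 = 0.1860   | level 2, `…LevelTwoK4`                       | 0.0431 (6)       | 4.3     |
| 5    | 11/65 = 0.1692  | level 2, `…LevelTwoK5`                       | 0.0362 (7)       | 4.7     |
| 6    | 5/32 = 0.1563   | level 2, `…LevelTwoK6`                       | 0.0351 (9)       | 4.4     |
| 7    | 3/20 = 0.1500   | level 1 far, `…LevelOneFar`                  | 0.0368 (12)      | 4.1     |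
| 8    | 1/7 = 0.1429    | level 1 far                                  | 0.0334 (13)      | 4.3     |
| 9    | 3/22 = 0.1364   | level 1 far                                  | 0.0307 (14)      | 4.4     |
| 10   | 4/31 = 0.1290   | level 1 far (level 2 kernel: 5/37, `…K10`)   | 0.0286 (15)      | 4.5     |
| 12   | 4/33 = 0.1212   | level 1 far                                  | 0.0255 (17)      | 4.7     |
| 15   | 1/9 = 0.1111    | level 1 far                                  | 0.0235 (21)      | 4.7     |
| 20   | 1/10            | level 1 far                                  | 0.0202 (26)      | 4.9     |
| 30   | 1/11            | level 1 far                                  | 0.0168 (36)      | 5.4     |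
| 50   | 1/13            | level 1 far                                  | 0.0147 (59)      | 5.2     |
| 100  | 1/15            | level 1 far                                  | 0.0126 (116)     | 5.3     |
| 200  | 1/18            | level 1 far                                  | 0.0110 (228)     | 5.0     |
| 500  | 1/21            | level 1 far                                  | 0.0095 (563)     | 5.0     |
| 1000 | 1/24            | level 1 far                                  | 0.0086 (1109)    | 4.8     |
| k ≥ 60 / 193 / 607 | 3/(8 ln k) / 1/(3 ln k) / 8/(25 ln k) | `…FarRate` (asymptotic bookkeeping) | — | — |

READING (numbers, not adjectives).  (i) The TABLE is the record for `k ≤ 2164` (`1/24 = 8/(25 ln k)` iff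
`ln k = 192/25`, `k = e^{7.68} ≈ 2164.6`); the rates of `…FarRate` are asymptotic bookkeeping of the same level-1 class, not better
rows (critic l.1386 s1).  (ii) STOP RULE for the upper side (critic l.1386 s2): the level-2 design search on `CW_q` is
SPENT at `k = 2 … 6` (integer designs sit `0.0014 – 0.0047` above the kernel's real optima and `0.008 / 0.012` above
print's level-4 values `ω(1,2,1) ≤ 3.2504`, `α ≥ 0.3215` of VXXZ 2024); the next movement of `δ̄₂ … δ̄₆` in theorem
currency needs laser LEVEL ≥ 4 value words (a different kernel), and of the far rows a design class with `q = k^{o(1)}`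
(the only window the `ζ^θ`-floor leaves below `Θ(1/ln k)`, `…DefectFloorFixedQ`).  (iii) The floors concern the
METHOD (BC9 ceiling of the family that produced every rung), not `ω(1,k,1)`: a ZERO of `δ_k` — the hypothesis of the
node at `k ≥ 3`, its conclusion at `k = 2` — is `CW_q`-T-method-unreachable at every grade and every `q`
(`…DefectFloorUniform.add_one_lt_of_tMethodBound_bigCw`), by the certified margins `β` at the grades of record.
(iv) §4: the laws of the profile (convexity, Lotti–Romani) transmit to `δ₂` exactly the `(k−2)/(k−1)`-damped square
defect: an onset `E_k` prices `δ₂ ≤ (k−2)/(k−1)·(ω−2)`; with the tree's PROVED `ω ≤ 2.37295` (Le Gall 2014, `CW_q^{⊗4}`) this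
is `ω(1,2,1) ≤ 3.1865` under `E₃` and `ω(1,2,1) ≤ 3.2487` under `E₄` (both below the unconditional `101/31 = 3.2581`),
and is VOID against `8/31` for every onset grade `k ≥ 5` (`0.37295·3/4 = 0.2797 > 0.2581`).  By lens 2's far-tail freedom theorem (`FarEdgeDescentTailClass.farPencil_iff`: the lawful
far excesses are exactly the convex, antitone, nonnegative, cube-line-coupled functions) the piecewise-linear excess
`e(x) = (ω−2)(k−x)₊/(k−1)` is lawful whenever `ω − 2 ≤ (k−1)/(k+2)`, so this chord price is ALL the 3D laws give toward
the node: the remaining `(k−2)/(k−1)·(ω−2) > 0` is the IDEA-NEEDED content of `TailDescentTwo` at onset `k`, in numbers.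

Sources: [cite: CoppersmithWinograd1990, §6–§8] (laser method on `CW_q`), [cite: LeGall2014, Table 2 and §6.3] (the proved
`ω ≤ 2.37295`), [cite: Coppersmith1997, §3] (far rectangular
designs), [cite: LottiRomani1983, §2 (p. 174)] (convexity of the profile), [cite: ChristandlLeGallLysikovZuiddam2025,
Thm. 3.15 with eq. (5)] (the `ζ^θ`-barrier for T-methods), [cite: LeGall2012, §1] (chord interpolation).
-/

set_option linter.dupNamespace false

noncomputable section

namespace Summit.MatrixMultiplication.MatrixMultiplication.Theorems.SaturationLadderDefectTable

open Literature.Computability.AlgebraicComplexity Literature.Barriers.MatrixMultiplication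
open Summit.MatrixMultiplication.MatrixMultiplication.Theorems

/-! ## §1 The upper ladder, literal: every priced grade by name -/

/-- **Head of the ladder** (the two grades below the far regime): `ω(1,3/10,1) = 2` (lens-1 level-2 theorem,
`α ≥ 3/10`) and the square defect `δ₁ = ω − 2 ≤ 0.37295` (the tree's proved fourth-power bound
`LeGall2014_cw4_omega_le`, `ω(1,1,1) = ω`). [cite: LeGall2014, Table 2 and §6.3] -/
theorem ladder_head_byName :
    omegaRect ℂ 1 ((3 : ℝ) / 10) 1 = 2 ∧ omegaRect ℂ 1 1 1 - 2 ≤ 0.37295 := by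
  refine ⟨SaturationLadderLevelTwo.omegaRect_one_3_10_one, ?_⟩
  have h := LeGall2014_cw4_omega_le ℂ
  rw [omegaRect_one_one_one]
  norm_num at h ⊢
  linarith

/-- **The nineteen priced grades `k = 2 … 1000`, literal types, by name** (level 2 for `k ≤ 6`, level-1 far
designs from `k = 7`; at `k = 10` both instruments are landed and the level-1 row `345/31` is the record). -/
theorem ladder_points_byName :
    omegaRect ℂ 1 2 1 ≤ 101 / 31 ∧ omegaRect ℂ 1 3 1 ≤ 80 / 19 ∧ omegaRect ℂ 1 4 1 ≤ 223 / 43 ∧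
    omegaRect ℂ 1 5 1 ≤ 401 / 65 ∧ omegaRect ℂ 1 6 1 ≤ 229 / 32 ∧ omegaRect ℂ 1 7 1 ≤ 163 / 20 ∧
    omegaRect ℂ 1 8 1 ≤ 64 / 7 ∧ omegaRect ℂ 1 9 1 ≤ 223 / 22 ∧ omegaRect ℂ 1 10 1 ≤ 345 / 31 ∧
    omegaRect ℂ 1 10 1 ≤ 412 / 37 ∧ omegaRect ℂ 1 12 1 ≤ 433 / 33 ∧ omegaRect ℂ 1 15 1 ≤ 145 / 9 ∧
    omegaRect ℂ 1 20 1 ≤ 211 / 10 ∧ omegaRect ℂ 1 30 1 ≤ 342 / 11 ∧ omegaRect ℂ 1 50 1 ≤ 664 / 13 ∧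
    omegaRect ℂ 1 100 1 ≤ 1516 / 15 ∧ omegaRect ℂ 1 200 1 ≤ 3619 / 18 ∧ omegaRect ℂ 1 500 1 ≤ 10522 / 21 ∧
    omegaRect ℂ 1 1000 1 ≤ 24025 / 24 :=
  ⟨SaturationLadderLevelTwoK2.omegaRect_one_two_one_le_101_31,
   SaturationLadderLevelTwoK3.omegaRect_one_three_one_le_80_19,
   SaturationLadderLevelTwoK4.omegaRect_one_four_one_le_223_43,
   SaturationLadderLevelTwoK5.omegaRect_one_five_one_le_401_65,
   SaturationLadderLevelTwoK6.omegaRect_one_six_one_le_229_32,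
   SaturationLadderLevelOneFar.omegaRect_one_seven_one_le,
   SaturationLadderLevelOneFar.omegaRect_one_eight_one_le,
   SaturationLadderLevelOneFar.omegaRect_one_nine_one_le,
   SaturationLadderLevelOneFar.omegaRect_one_ten_one_le,
   SaturationLadderLevelTwoK10.omegaRect_one_ten_one_le_412_37,
   SaturationLadderLevelOneFar.omegaRect_one_twelve_one_le,
   SaturationLadderLevelOneFar.omegaRect_one_fifteen_one_le,
   SaturationLadderLevelOneFar.omegaRect_one_twenty_one_le,
   SaturationLadderLevelOneFar.omegaRect_one_thirty_one_le,
   SaturationLadderLevelOneFar.omegaRect_one_fifty_one_le,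
   SaturationLadderLevelOneFar.omegaRect_one_hundred_one_le,
   SaturationLadderLevelOneFar.omegaRect_one_twoHundred_one_le,
   SaturationLadderLevelOneFar.omegaRect_one_fiveHundred_one_le,
   SaturationLadderLevelOneFar.omegaRect_one_thousand_one_le⟩

/-- **The defect ladder of record as exact rationals** `δ̄_k` (the table's second column):
`8/31, 4/19, 8/43, 11/65, 5/32, 3/20, 1/7, 3/22, 4/31, 4/33, 1/9, 1/10, 1/11, 1/13, 1/15, 1/18, 1/21, 1/24`. -/
theorem defect_record :
    omegaRect ℂ 1 2 1 - 3 ≤ 8 / 31 ∧ omegaRect ℂ 1 3 1 - 4 ≤ 4 / 19 ∧ omegaRect ℂ 1 4 1 - 5 ≤ 8 / 43 ∧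
    omegaRect ℂ 1 5 1 - 6 ≤ 11 / 65 ∧ omegaRect ℂ 1 6 1 - 7 ≤ 5 / 32 ∧ omegaRect ℂ 1 7 1 - 8 ≤ 3 / 20 ∧
    omegaRect ℂ 1 8 1 - 9 ≤ 1 / 7 ∧ omegaRect ℂ 1 9 1 - 10 ≤ 3 / 22 ∧ omegaRect ℂ 1 10 1 - 11 ≤ 4 / 31 ∧
    omegaRect ℂ 1 12 1 - 13 ≤ 4 / 33 ∧ omegaRect ℂ 1 15 1 - 16 ≤ 1 / 9 ∧ omegaRect ℂ 1 20 1 - 21 ≤ 1 / 10 ∧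
    omegaRect ℂ 1 30 1 - 31 ≤ 1 / 11 ∧ omegaRect ℂ 1 50 1 - 51 ≤ 1 / 13 ∧
    omegaRect ℂ 1 100 1 - 101 ≤ 1 / 15 ∧ omegaRect ℂ 1 200 1 - 201 ≤ 1 / 18 ∧
    omegaRect ℂ 1 500 1 - 501 ≤ 1 / 21 ∧ omegaRect ℂ 1 1000 1 - 1001 ≤ 1 / 24 := by
  obtain ⟨h2, h3, h4, h5, h6, h7, h8, h9, h10, -, h12, h15, h20, h30, h50, h100, h200, h500, h1000⟩ :=
    ladder_points_byName
  refine ⟨?_, ?_, ?_, ?_, ?_, ?_, ?_, ?_, ?_, ?_, ?_, ?_, ?_, ?_, ?_, ?_, ?_, ?_⟩ <;> linarith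

/-! ## §2 Tails: the ladder as a step function on all real grades `k ≥ 2` -/

/-- **Tails by name**: from each priced grade `k₀` on, `δ_k ≤ δ̄_{k₀}` for every REAL `k ≥ k₀` (antitonicity of
the defect, `omegaRect_one_mid_one_le_add`; the `k₀ ≥ 7` conjuncts are the landed `defect_le_of_*` verbatim). -/
theorem defect_tails_byName :
    (∀ k : ℝ, 2 ≤ k → omegaRect ℂ 1 k 1 - (k + 1) ≤ 8 / 31) ∧
    (∀ k : ℝ, 3 ≤ k → omegaRect ℂ 1 k 1 - (k + 1) ≤ 4 / 19) ∧
    (∀ k : ℝ, 4 ≤ k → omegaRect ℂ 1 k 1 - (k + 1) ≤ 8 / 43) ∧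
    (∀ k : ℝ, 5 ≤ k → omegaRect ℂ 1 k 1 - (k + 1) ≤ 11 / 65) ∧
    (∀ k : ℝ, 6 ≤ k → omegaRect ℂ 1 k 1 - (k + 1) ≤ 5 / 32) ∧
    (∀ k : ℝ, 7 ≤ k → omegaRect ℂ 1 k 1 - (k + 1) ≤ 3 / 20) ∧
    (∀ k : ℝ, 8 ≤ k → omegaRect ℂ 1 k 1 - (k + 1) ≤ 1 / 7) ∧
    (∀ k : ℝ, 9 ≤ k → omegaRect ℂ 1 k 1 - (k + 1) ≤ 3 / 22) ∧
    (∀ k : ℝ, 10 ≤ k → omegaRect ℂ 1 k 1 - (k + 1) ≤ 4 / 31) ∧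
    (∀ k : ℝ, 12 ≤ k → omegaRect ℂ 1 k 1 - (k + 1) ≤ 4 / 33) ∧
    (∀ k : ℝ, 15 ≤ k → omegaRect ℂ 1 k 1 - (k + 1) ≤ 1 / 9) ∧
    (∀ k : ℝ, 20 ≤ k → omegaRect ℂ 1 k 1 - (k + 1) ≤ 1 / 10) ∧
    (∀ k : ℝ, 30 ≤ k → omegaRect ℂ 1 k 1 - (k + 1) ≤ 1 / 11) ∧
    (∀ k : ℝ, 50 ≤ k → omegaRect ℂ 1 k 1 - (k + 1) ≤ 1 / 13) ∧
    (∀ k : ℝ, 100 ≤ k → omegaRect ℂ 1 k 1 - (k + 1) ≤ 1 / 15) ∧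
    (∀ k : ℝ, 200 ≤ k → omegaRect ℂ 1 k 1 - (k + 1) ≤ 1 / 18) ∧
    (∀ k : ℝ, 500 ≤ k → omegaRect ℂ 1 k 1 - (k + 1) ≤ 1 / 21) ∧
    (∀ k : ℝ, 1000 ≤ k → omegaRect ℂ 1 k 1 - (k + 1) ≤ 1 / 24) := by
  obtain ⟨h2, h3, h4, h5, h6, -⟩ := ladder_points_byName
  refine ⟨fun k hk => ?_, fun k hk => ?_, fun k hk => ?_, fun k hk => ?_, fun k hk => ?_,
    SaturationLadderLevelOneFar.defect_le_of_seven, SaturationLadderLevelOneFar.defect_le_of_eight,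
    SaturationLadderLevelOneFar.defect_le_of_nine, SaturationLadderLevelOneFar.defect_le_of_ten,
    SaturationLadderLevelOneFar.defect_le_of_twelve, SaturationLadderLevelOneFar.defect_le_of_fifteen,
    SaturationLadderLevelOneFar.defect_le_of_twenty, SaturationLadderLevelOneFar.defect_le_of_thirty,
    SaturationLadderLevelOneFar.defect_le_of_fifty, SaturationLadderLevelOneFar.defect_le_of_hundred,
    SaturationLadderLevelOneFar.defect_le_of_twoHundred, SaturationLadderLevelOneFar.defect_le_of_fiveHundred,
    SaturationLadderLevelOneFar.defect_le_of_thousand⟩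
  · have h := SaturationLadderLevelOneFar.defect_le_of_far_point h2 hk; linarith
  · have h := SaturationLadderLevelOneFar.defect_le_of_far_point h3 hk; linarith
  · have h := SaturationLadderLevelOneFar.defect_le_of_far_point h4 hk; linarith
  · have h := SaturationLadderLevelOneFar.defect_le_of_far_point h5 hk; linarith
  · have h := SaturationLadderLevelOneFar.defect_le_of_far_point h6 hk; linarith

/-- **Asymptotic bookkeeping of the level-1 far class** (not better rows: `1/24 < 8/(25 ln k)` iff `ln k < 192/25`,
`k < e^{7.68} ≈ 2165`, and `…LevelOneFar`'s table is the record below that): the three clean rates by name. -/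
theorem farRates_byName :
    (∀ k : ℕ, 60 ≤ k → omegaRect ℂ 1 k 1 - (k + 1) ≤ 3 / (8 * Real.log k)) ∧
    (∀ k : ℕ, 193 ≤ k → omegaRect ℂ 1 k 1 - (k + 1) ≤ 1 / (3 * Real.log k)) ∧
    (∀ k : ℕ, 607 ≤ k → omegaRect ℂ 1 k 1 - (k + 1) ≤ 8 / (25 * Real.log k)) :=
  ⟨SaturationLadderFarRate.farRate_three_eighths, SaturationLadderFarRate.farRate_third,
   SaturationLadderFarRate.farRate_eight_25ths⟩

/-! ## §3 The `CW_q`-method floor under every priced grade, literal, by name -/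

/-- **The floor column `β` at the `q` of record, all eighteen priced grades** (`ζ^θ`-barrier rows of
`…DefectFloor{,Far,Near,Mid,Seven,Twelve,TwoHundred}` and the tree's `omegaTwo_bigCw_6`): for every field `K` and
every real `ω̂`, a `CW_q`-method bound `ω̂` on `ω(k)` satisfies `k + 1 + β ≤ ω̂`.
[cite: ChristandlLeGallLysikovZuiddam2025, Thm. 3.15 with eq. (5)] -/
theorem floor_rows_byName (K : Type) [Field K] (ω : ℝ) :
    (IsTMethodBound K (bigCwTensor K 6) 2 ω → (3.1039 : ℝ) ≤ ω) ∧
    (IsTMethodBound K (bigCwTensor K 6) 3 ω → (4.0626 : ℝ) ≤ ω) ∧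
    (IsTMethodBound K (bigCwTensor K 6) 4 ω → (5.0431 : ℝ) ≤ ω) ∧
    (IsTMethodBound K (bigCwTensor K 7) 5 ω → (6.0362 : ℝ) ≤ ω) ∧
    (IsTMethodBound K (bigCwTensor K 9) 6 ω → (7.0351 : ℝ) ≤ ω) ∧
    (IsTMethodBound K (bigCwTensor K 12) 7 ω → (8.0368 : ℝ) ≤ ω) ∧
    (IsTMethodBound K (bigCwTensor K 13) 8 ω → (9.0334 : ℝ) ≤ ω) ∧
    (IsTMethodBound K (bigCwTensor K 14) 9 ω → (10.0307 : ℝ) ≤ ω) ∧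
    (IsTMethodBound K (bigCwTensor K 15) 10 ω → (11.0286 : ℝ) ≤ ω) ∧
    (IsTMethodBound K (bigCwTensor K 17) 12 ω → (13.0255 : ℝ) ≤ ω) ∧
    (IsTMethodBound K (bigCwTensor K 21) 15 ω → (16.0235 : ℝ) ≤ ω) ∧
    (IsTMethodBound K (bigCwTensor K 26) 20 ω → (21.0202 : ℝ) ≤ ω) ∧
    (IsTMethodBound K (bigCwTensor K 36) 30 ω → (31.0168 : ℝ) ≤ ω) ∧
    (IsTMethodBound K (bigCwTensor K 59) 50 ω → (51.0147 : ℝ) ≤ ω) ∧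
    (IsTMethodBound K (bigCwTensor K 116) 100 ω → (101.0126 : ℝ) ≤ ω) ∧
    (IsTMethodBound K (bigCwTensor K 228) 200 ω → (201.0110 : ℝ) ≤ ω) ∧
    (IsTMethodBound K (bigCwTensor K 563) 500 ω → (501.0095 : ℝ) ≤ ω) ∧
    (IsTMethodBound K (bigCwTensor K 1109) 1000 ω → (1001.0086 : ℝ) ≤ ω) :=
  ⟨fun h => omegaTwo_bigCw_6 K h,
   fun h => SaturationLadderDefectFloorNear.omega3_bigCw_6 K h,
   fun h => SaturationLadderDefectFloorNear.omega4_bigCw_6 K h,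
   fun h => SaturationLadderDefectFloorMid.omega5_bigCw_7 K h,
   fun h => SaturationLadderDefectFloorMid.omega6_bigCw_9 K h,
   fun h => SaturationLadderDefectFloorSeven.omega7_bigCw_12 K h,
   fun h => SaturationLadderDefectFloorSeven.omega8_bigCw_13 K h,
   fun h => SaturationLadderDefectFloorSeven.omega9_bigCw_14 K h,
   fun h => SaturationLadderDefectFloor.omega10_bigCw_15 K h,
   fun h => SaturationLadderDefectFloorTwelve.omega12_bigCw_17 K h,
   fun h => SaturationLadderDefectFloorTwelve.omega15_bigCw_21 K h,
   fun h => SaturationLadderDefectFloor.omega20_bigCw_26 K h,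
   fun h => SaturationLadderDefectFloorTwelve.omega30_bigCw_36 K h,
   fun h => SaturationLadderDefectFloorFar.omega50_bigCw_59 K h,
   fun h => SaturationLadderDefectFloorFar.omega100_bigCw_116 K h,
   fun h => SaturationLadderDefectFloorTwoHundred.omega200_bigCw_228 K h,
   fun h => SaturationLadderDefectFloorTwoHundred.omega500_bigCw_563 K h,
   fun h => SaturationLadderDefectFloorFar.omega1000_bigCw_1109 K h⟩

/-- **The two off-record columns**: at FIXED `q = 6` the floor decays like `≈ 0.3/(k ln k)` (rows at
`k = 10, 20, 50`), and WIDE `q` is provably non-competitive — at `(k, Q) = (2, 64), (10, 160), (1000, 8000)` every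
`CW_Q`-method bound is strictly WEAKER than the tree's proved row. [cite: ChristandlLeGallLysikovZuiddam2025, Thm. 3.15 with eq. (5)] -/
theorem floor_columns_byName (K : Type) [Field K] (ω : ℝ) :
    (IsTMethodBound K (bigCwTensor K 6) 10 ω → (11.0128 : ℝ) ≤ ω) ∧
    (IsTMethodBound K (bigCwTensor K 6) 20 ω → (21.0051 : ℝ) ≤ ω) ∧
    (IsTMethodBound K (bigCwTensor K 6) 50 ω → (51.0015 : ℝ) ≤ ω) ∧
    (IsTMethodBound K (bigCwTensor K 64) 2 ω → omegaRect ℂ 1 2 1 < ω) ∧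
    (IsTMethodBound K (bigCwTensor K 160) 10 ω → omegaRect ℂ 1 10 1 < ω) ∧
    (IsTMethodBound K (bigCwTensor K 8000) 1000 ω → omegaRect ℂ 1 1000 1 < ω) :=
  ⟨fun h => SaturationLadderDefectFloorFixedQ.omega10_bigCw_6 K h,
   fun h => SaturationLadderDefectFloorFixedQ.omega20_bigCw_6 K h,
   fun h => SaturationLadderDefectFloorFixedQ.omega50_bigCw_6 K h,
   fun h => SaturationLadderDefectFloorWide.omegaRect_one_two_one_lt_of_bigCw_64 K h,
   fun h => SaturationLadderDefectFloorWide.omegaRect_one_ten_one_lt_of_bigCw_160 K h,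
   fun h => SaturationLadderDefectFloorWide.omegaRect_one_thousand_one_lt_of_bigCw_8000 K h⟩

/-! ### Uniform floor (by reference, not imported)

The qualitative statement behind every row — for every field `K`, every `q` and every real grade `p ≥ 1`, a
`CW_q`-method bound `ω̂` on `ω(p)` satisfies `p + 1 < ω̂`, so a ZERO of the defect (the node's hypothesis at `k ≥ 3`,
its conclusion at `k = 2`) is certified by no `CW_q`-method — is the landed
`SaturationLadderDefectFloorUniform.add_one_lt_of_tMethodBound_bigCw` /
`omegaRect_lt_tMethodBound_of_eq_add_one` (gen 22 part E).  That module imports the route file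
`Theses.SaturationLadder`, so it is deliberately NOT imported here: this index is route-independent (no rebuild on a
route edit, gate lint `theses-cone`). -/

/-- **Sandwich at the two ends of the table**: floor `k + 1 ≤ ω(1,k,1)`, proved row, and the proved row lies
INSIDE the window the `ζ^θ`-barrier leaves at its own `q` (`3.1039 < 101/31`, `1001.0086 < 24025/24`) — the record
rows are barrier-consistent and non-vacuous at `k = 2` and `k = 1000`. -/
theorem sandwich_ends :
    ((3 : ℝ) ≤ omegaRect ℂ 1 2 1 ∧ omegaRect ℂ 1 2 1 ≤ 101 / 31 ∧ (101 : ℝ) / 31 > 3.1039) ∧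
    ((1001 : ℝ) ≤ omegaRect ℂ 1 1000 1 ∧ omegaRect ℂ 1 1000 1 ≤ 24025 / 24 ∧ (24025 : ℝ) / 24 > 1001.0086) := by
  have h2 := add_one_le_omegaRect_one_mid_one (K := ℂ) (2 : ℝ)
  have h1000 := add_one_le_omegaRect_one_mid_one (K := ℂ) (1000 : ℝ)
  refine ⟨⟨by norm_num at h2 ⊢; exact h2, ladder_points_byName.1, by norm_num⟩,
    ⟨by norm_num at h1000 ⊢; exact h1000, ladder_points_byName.2.2.2.2.2.2.2.2.2.2.2.2.2.2.2.2.2.2, by norm_num⟩⟩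

/-! ## §4 The law price of an onset for the square-adjacent grade (what convexity alone gives toward the node) -/

/-- **Chord of the convex profile through `a = 1` and `a = k`** (Lotti–Romani convexity of `a ↦ ω(1,a,1)` on
`[0,∞)`, tree `omegaRect_convexOn_one_mid_one`, evaluated at `2 = (k−2)/(k−1)·1 + 1/(k−1)·k`):
`(k−1)·ω(1,2,1) ≤ (k−2)·ω + ω(1,k,1)` for every real `k ≥ 3`. [cite: LottiRomani1983, §2 (p. 174)] [cite: LeGall2012, §1] -/
theorem chord_one_two_of_three_le {k : ℝ} (hk : 3 ≤ k) :
    (k - 1) * omegaRect ℂ 1 2 1 ≤ (k - 2) * omega ℂ + omegaRect ℂ 1 k 1 := by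
  have hk1 : 0 < k - 1 := by linarith
  have hk1' : k - 1 ≠ 0 := ne_of_gt hk1
  have ha : (0 : ℝ) ≤ (k - 2) / (k - 1) := div_nonneg (by linarith) hk1.le
  have hb : (0 : ℝ) ≤ 1 / (k - 1) := div_nonneg zero_le_one hk1.le
  have e1 : (k - 1) * ((k - 2) / (k - 1)) = k - 2 := by field_simp
  have e2 : (k - 1) * (1 / (k - 1)) = 1 := by field_simp
  have hab : (k - 2) / (k - 1) + 1 / (k - 1) = 1 := by
    have : (k - 1) * ((k - 2) / (k - 1) + 1 / (k - 1)) = (k - 1) * 1 := by rw [mul_add, e1, e2]; ring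
    exact mul_left_cancel₀ hk1' this
  have h2 : (k - 2) / (k - 1) * 1 + 1 / (k - 1) * k = 2 := by
    rw [mul_one]
    have : (k - 1) * ((k - 2) / (k - 1) + 1 / (k - 1) * k) = (k - 1) * 2 := by
      rw [mul_add, e1, ← mul_assoc, e2]; ring
    exact mul_left_cancel₀ hk1' this
  have hc := (omegaRect_convexOn_one_mid_one ℂ).2 (Set.mem_Ici.2 (zero_le_one : (0 : ℝ) ≤ 1))
    (Set.mem_Ici.2 (by linarith : (0 : ℝ) ≤ k)) ha hb hab
  simp only [smul_eq_mul] at hc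
  rw [h2, omegaRect_one_one_one] at hc
  calc (k - 1) * omegaRect ℂ 1 2 1
      ≤ (k - 1) * ((k - 2) / (k - 1) * omega ℂ + 1 / (k - 1) * omegaRect ℂ 1 k 1) :=
        mul_le_mul_of_nonneg_left hc hk1.le
    _ = (k - 1) * ((k - 2) / (k - 1)) * omega ℂ + (k - 1) * (1 / (k - 1)) * omegaRect ℂ 1 k 1 := by ring
    _ = (k - 2) * omega ℂ + omegaRect ℂ 1 k 1 := by rw [e1, e2, one_mul]

/-- **Law price of an onset**: `E_k : ω(1,k,1) = k+1` with `k ≥ 3` forces `δ₂ ≤ (k−2)/(k−1)·(ω − 2)` — the laws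
transmit to the square-adjacent grade exactly the `(k−2)/(k−1)`-damped square defect (sharp among 3D-lawful
profiles by lens 2's `FarEdgeDescentTailClass.farPencil_iff` whenever `ω − 2 ≤ (k−1)/(k+2)`, which the proved
`ω − 2 ≤ 0.37295 < 2/5` guarantees at every `k ≥ 3`).
[cite: LottiRomani1983, §2 (p. 174)] -/
theorem defect_two_le_of_onset {k : ℝ} (hk : 3 ≤ k) (hE : omegaRect ℂ 1 k 1 = k + 1) :
    omegaRect ℂ 1 2 1 - 3 ≤ (k - 2) / (k - 1) * (omega ℂ - 2) := by
  have h := chord_one_two_of_three_le hk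
  rw [hE] at h
  have hk1 : 0 < k - 1 := by linarith
  rw [div_mul_eq_mul_div, le_div_iff₀ hk1]
  nlinarith [h]

/-- **In proved currency, at the first two onset grades**: `E₃ : ω(1,3,1) = 4` gives `ω(1,2,1) ≤ 3.1865` (half the
proved square defect `ω − 2 ≤ 0.37295`, `LeGall2014_cw4_omega_le`) and `E₄ : ω(1,4,1) = 5` gives `ω(1,2,1) ≤ 3.2487`
(two thirds of it) — both below the unconditional record `101/31 = 3.2581`; for every onset grade `k ≥ 5` the price
`(k−2)/(k−1)·0.37295 ≥ 0.2797` is VOID against `8/31`.  The node asks `= 3`. [cite: LeGall2014, Table 2 and §6.3] -/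
theorem omegaRect_one_two_one_le_of_onset_three (hE : omegaRect ℂ 1 3 1 = 4) :
    omegaRect ℂ 1 2 1 ≤ 3.1865 := by
  have h := chord_one_two_of_three_le (k := 3) (by norm_num)
  rw [hE] at h
  have hω := LeGall2014_cw4_omega_le ℂ
  norm_num at h hω ⊢
  linarith

/-- The second onset grade in proved currency: `E₄ ⟹ ω(1,2,1) ≤ 3.2487 < 101/31`. [cite: LeGall2014, Table 2 and §6.3] -/
theorem omegaRect_one_two_one_le_of_onset_four (hE : omegaRect ℂ 1 4 1 = 5) :
    omegaRect ℂ 1 2 1 ≤ 3.2487 ∧ (3.2487 : ℝ) < 101 / 31 := by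
  have h := chord_one_two_of_three_le (k := 4) (by norm_num)
  rw [hE] at h
  have hω := LeGall2014_cw4_omega_le ℂ
  refine ⟨?_, by norm_num⟩
  norm_num at h hω ⊢
  linarith

/-! ## §5 Ledger line for the node -/

/-- **`TailDescentTwo` on the ladder** (the node `(∃ k ≥ 3, ω(1,k,1) = k+1) → ω(1,2,1) = 3` of route
`SaturationLadder`, stated here by its text — the route file is not imported, see §3): what the tree PROVES about its
conclusion is the price `3 ≤ ω(1,2,1) ≤ 3 + 8/31` unconditionally, `ω(1,2,1) ≤ 3.1865` under the onset `E₃` and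
`≤ 3.2487` under `E₄`, nothing under `E_k`, `k ≥ 5`, beyond the unconditional row; the equality `= 3` is reached by
no `CW_q`-method (§3) and by no law of the profile (§4). -/
theorem node_conclusion_priced :
    ((3 : ℝ) ≤ omegaRect ℂ 1 2 1 ∧ omegaRect ℂ 1 2 1 - 3 ≤ 8 / 31) ∧
    (omegaRect ℂ 1 3 1 = 4 → omegaRect ℂ 1 2 1 ≤ 3.1865) ∧
    (omegaRect ℂ 1 4 1 = 5 → omegaRect ℂ 1 2 1 ≤ 3.2487) ∧
    (∀ k : ℝ, 3 ≤ k → omegaRect ℂ 1 k 1 = k + 1 → omegaRect ℂ 1 2 1 - 3 ≤ (k - 2) / (k - 1) * (omega ℂ - 2)) :=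
  ⟨⟨sandwich_ends.1.1, defect_record.1⟩, omegaRect_one_two_one_le_of_onset_three,
    fun h => (omegaRect_one_two_one_le_of_onset_four h).1, fun _ hk hE => defect_two_le_of_onset hk hE⟩

end Summit.MatrixMultiplication.MatrixMultiplication.Theorems.SaturationLadderDefectTable

end
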